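import Literature.MathematicalPhysics.QuantumFieldTheory.Balaban1983to89.B2Ineq335Printed
import Literature.MathematicalPhysics.QuantumFieldTheory.Balaban1983to89.B2Prop31ZeroFieldConcrete
import Literature.MathematicalPhysics.QuantumFieldTheory.Balaban1983to89.B2Ineq339Gathering

/-!
# `Balaban1983to89.B2Ineq335ZeroFieldConcrete` — [Balaban1982Higgs2] §3.B pp. 589–591: **(3.35) and (3.39) AT ZERO
FIELD ON THE CONCRETE (Higgs)₂,₃ CARRIER WITH PROPOSITION 3.1 DISCHARGED** — the schematic «(3.22) ⇒ (3.35)» theorem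
`B2Ineq335Printed.ineq335` (this seat, gen 6) instantiated with the zero-field (3.25) density `Z(0)e^{−½⟨Φ,Δ(0)Φ⟩}` of the
concrete (3.23)/(3.24) carrier (`B2Eq325ConcreteSchur`, gen 4) and its Proposition 3.1 input supplied by
`B2Prop31ZeroFieldConcrete.prop31_zeroField_concrete` (gen 4, hypothesis-free), then knitted with
`B2Ineq339Gathering.ineq339_knit` ((3.36) = (3.37) ≤ (3.38) ⇒ (3.39) on the same carrier, gen 4 + r14 + p28): the
scalar-field chain (3.22) ⇒ (3.39) of §3.B holds at `Ã^ε = 0` with NO (3.26)/(3.35) hypothesis left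

statement-level skeleton of published theorems with citation tags; proofs where landed; nothing here is a claim about the Yang–Mills mass gap

CITATION HEADER.  T. Bałaban, *(Higgs)₂,₃ quantum fields in a finite volume. II. An upper bound*, Commun. Math. Phys.
**86** (1982) 555–594 [Balaban1982Higgs2] (cell paper B2; PDF held `paper:balaban1982-cmp86-higgs23-ii`, journal page =
PDF page + 554; pp. 588–591 READ AS IMAGES on the ×2 renders
`run/shared/lean/pub/pub-balaban/b2b-balaban-ref1/pages/1982-cmp86-higgs23-II/1982-cmp86-higgs23-II-p034-x2.png` … `-p037-x2.png`).
Unit `lit-balaban-p15` gen 6 (Phase-2 proof seat p15; HOME `run/shared/lean/pub/lit-balaban/`).  SKELETON rows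
**B2.Eq3.32** ((3.30)–(3.41), member (3.35); fold owner r02) and **B2.Prop3.1** (zero-field clause p. 589).  USED BY NAME
(nothing restated): `B2Ineq335Printed.ineq335` (+ `B2Ineq335Exceptions.rhs322`, r14's `B2Eq337LastIntegrations.gaussLevel`);
gen 4's `B2Eq337ScalarIntegration.{Regions, Cfg, F325, dens, continuous_dens, integral_gField_pos, finrank_V}`,
`B2Eq325ConcreteSchur.{form325, Z325, eq325_concrete, Z325_pos}`, `B2Eq328ConcretePieces.{Nested, outF, bond0, mass0, resL,
bond0_eq_sum}`, `B2Eq328DeltaK.extL`, `B2Prop31ZeroFieldConcrete.{bondK, massK, gamma0, prop31_zeroField_concrete}`,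
`B2Ineq339Gathering.{vol, eq336_concrete, ineq339_knit}`, `B2Ineq338Diamagnetic.E0s`; Mathlib
`MeasurableEquiv.sumPiEquivProdPi` / `volume_measurePreserving_sumPiEquivProdPi` (the transport `Φ ↔ (φ₀↾_{Λ₅⁽⁰⁾ᶜ},
(φ_k↾_{Λ_k})_k)`).

THE SOURCE TEXT (verbatim).  Prop. 3.1 p. 589: *"⟨Φ, Δ(Ã^ε)Φ⟩ ≧ γ₀Σ_{k=0}^{K}Σ_{⟨x,x′⟩⊂Λ₅⁽ᵏ⁻¹⁾′∩Λ₅⁽ᵏ⁾ᶜ}(Lᵏε)^{d−2}|U(Ã^ε(⟨x,x′⟩))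
φ_k(x′) − φ_k(x)|² + γ₀Σ_{k=0}^{K}Σ_{x∈Λ₅⁽ᵏ⁻¹⁾′∩Λ₅⁽ᵏ⁾ᶜ}(Lᵏε)^d m²|φ_k(x)|² − Σ_{k=1}^{K}O((Lᵏε)^{κ₀})|(Λ₅⁽ᵏ⁻¹⁾′∩Λ₅⁽ᵏ⁾ᶜ)₁|, (3.26)
… If Ã^ε = 0, then the inequality holds without the last sum on the right side and without any restrictions on the
configuration Φ."*  (3.35) p. 591: *"(the right side of (3.22)) ≦ ∫dΦ Z(Ã^ε)·exp(−¼⟨Φ, Δ(Ã^ε)Φ⟩) Π_{k=0}^{K−1} ζ′_{Λ₀⁽ᵏ⁾} ·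
exp Σ_{k=1}^{K} O((Lᵏε)^{κ₀})|Λ_k|."*  (3.39) p. 591: *"(the expression {…} on the left side of (3.22)) ≦ Π_{k=0}^{K−1} ζ′_{Λ₀⁽ᵏ⁾}
exp(E_{0,s}) exp(O(1) Σ_{k=0}^{K}|Λ_k|)."*  (The text of (3.30)–(3.34) is quoted in `B2Ineq335Exceptions`.)

THE MODEL.  Level 0 of the schematic chain of `B2Ineq335Exceptions` (the kept variables `Φ`) is the CONCRETE configuration
space of (3.24): the fields on the finite type `KSite R = R.OutSite ⊕ R.BlockSite` (`Λ₅⁽⁰⁾ᶜ ⊔ ⨆_{k=1}^{K}Λ_k`), identified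
with gen 4's `Cfg R N = (R.OutSite → ℝ^N) × (R.BlockSite → ℝ^N)` by the volume-preserving `cfgOf` (§1); the levels `n+1`
are schematic finite output-site types `O (n+1)` (↤ `Λ₅⁽ⁿ⁾ᶜ′`) with r14's Gaussian kernels `gaussLevel` of precision `a·s_n`
and history-dependent centres `c_n` (↤ `Q(0)φ_n`), the printed large-field indicators at the sites of `P_s⁽ⁿ⁾`
(`largeFieldSite`), the other characteristic functions `b ∈ [0,1]`, family weights `w` (↤ `χᶜ_{P_v}χᶜ_{Q_v}χᶜ_{R_v}e^{−p²|R_s|}`),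
all as in `B2Ineq335Printed.ineq335`.  CONCRETE are: the weight `F = Z(0)e^{−½⟨Φ,Δ(0)Φ⟩}` with `⟨Φ,Δ(0)Φ⟩ = form325 R C a 0 m²`
and `Z(0) = Z325 R C a 0 m²` of gen 4's (3.25) (`= F325`, the integral (3.23) with its constants: `weight_eq_F325`); the k-th
term of (3.26) at zero field — its bonds `bondSet R k` (`k = 0`: the positive bonds inside `Λ₅⁽⁰⁾ᶜ`; `k = n+1 ≤ K`: those
inside `Λ_{n+1}`), its bond terms `bondTerm` (`(Lᵏε)^d|(∂φ_k)(b)|²`, `U ≡ 1`), its mass part `massTerm` (`mass0`, `massK`),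
`γ₀ = gamma0 P a m² = min(a(1−L⁻²)/(8d+2m²), ¼)`, NO error terms (`E ≡ 0`); the bond restrictions `χᶜ_{Q_s⁽ʲ⁾}` read these
concrete bond terms (`hlarge`: `= 1` forces `bondTerm > r_j` on `Q_s⁽ʲ⁾ ⊆ bondSet R j`).

WHAT IS PROVED (kernel-checked, 0 `sorry`, standard axioms).
§1 `KSite`, `Sites` (+ `Fintype`/`DecidableEq` instances), `cfgOf`, `measurePreserving_cfgOf`.
§2 `Bnd`, `bondSet`, `bondTerm`, `massTerm` (defs with bodies), `bondTerm_nonneg`, `massTerm_nonneg`, `sum_bondSet_zero`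
   (= `bond0` at `Ã = 0`), `sum_bondSet_succ` (= `bondK`), `sum_levels_eq`, **`h326_zeroField`** (the right side of (3.26)
   at zero field summed over `k ≤ K` is `≤ form325(Φ)` for EVERY `Φ`: `prop31_zeroField_concrete`), `measurable_F325`
   (parametric integral of the jointly continuous density), `measurable_form325` (`⟨Φ,ΔΦ⟩ = −2 log(F325/Z)`), `weight_eq_F325`.
§3 **`ineq335_zeroField`**: `(3.22) ≤ ∫dΦ Z(0)e^{−¼⟨Φ,Δ(0)Φ⟩} · Π_{j<K}Σ_τ w_{j,τ}e^{−¼γ₀r_j|Q_s⁽ʲ⁾(τ)|}(e^{−⅛ar_j})^{|P_s⁽ʲ⁾(τ)|}` —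
   (3.35) with NO error factor, for nested region data `R` (`K ≤` the number of scales, `Lᴷε ≤ 1`), `m² > 0`, `a > 0`, `L > 1`,
   from `hlarge` and `4N log 2 ≤ a r_j` alone (Prop. 3.1 DISCHARGED).
§4 `integrable_weight4` (`∫dΦ Z(0)e^{−¼⟨Φ,Δ(0)Φ⟩} = 2^{dim/2}∫F325 = 2^{dim/2}∫dφ₀e^{−½⟨φ₀,(−Δ+m²)φ₀⟩} ≠ 0`), `lintegral_weight4_eq`
   (transport + `ofReal`), **`ineq339_zeroField`**: `((3.22)).toReal ≤ Π_{j<K}ζ′_j · exp(E_{0,s}) · exp(½N log 2·(|Λ₅⁽⁰⁾ᶜ| +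
   Σ_k|Λ_k|))` with `ζ′_j = Σ_τ w_{j,τ}e^{−¼γ₀r_j|Q|}(e^{−⅛ar_j})^{|P|}` (real weights `w ≥ 0`) — gen 4's `ineq339_knit` with its
   `h335` SUPPLIED (`c ≡ 0`, `C₀ = 0`): (3.22) ⇒ (3.39) at zero field with no (3.26)/(3.35) hypothesis.
HONEST SCOPE.  (i) Zero external field only (`Ã^ε = 0`): the restricted clause of Prop. 3.1 for `Ã^ε ≠ 0` (input B4
Prop. 3.1′, GAPS G-pv07-1) is not in the tree, so the general-`Ã` version keeps (3.26) as the hypothesis `h326` of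
`B2Ineq335Printed.ineq335`.  (ii) The OUTPUT structure stays schematic (output sites, centres `Q(0)φ_n`, exceptional sites,
families, weights are data; the (3.21) → (3.22) composition is not constructed), exactly as in files 1/2–2/2 of (3.35);
what is concrete is everything Proposition 3.1 talks about.  (iii) `lhs` of (3.39) is `(rhs322 …).toReal`, finite by the
bound itself.  Value = the published §3.B scalar chain closed at zero field on the concrete carrier; NOT summit progress.
-/

noncomputable section

open MeasureTheory Finset Function Real
open scoped ENNReal BigOperators

namespace Literature.MathematicalPhysics.QuantumFieldTheory.Balaban1983to89.B2Ineq335ZeroFieldConcrete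

open Literature.MathematicalPhysics.QuantumFieldTheory.Balaban1983to89.HiggsCovariancePos (Inside)
open Literature.MathematicalPhysics.QuantumFieldTheory.Balaban1983to89.B2Ineq338Diamagnetic
open Literature.MathematicalPhysics.QuantumFieldTheory.Balaban1983to89.B2Eq337ScalarIntegration
open Literature.MathematicalPhysics.QuantumFieldTheory.Balaban1983to89.B2Eq325ConcreteSchur
open Literature.MathematicalPhysics.QuantumFieldTheory.Balaban1983to89.B2Eq328ConcretePieces
open Literature.MathematicalPhysics.QuantumFieldTheory.Balaban1983to89.B2Eq328DeltaK
open Literature.MathematicalPhysics.QuantumFieldTheory.Balaban1983to89.B2Prop31ZeroFieldConcrete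
open Literature.MathematicalPhysics.QuantumFieldTheory.Balaban1983to89.B2Ineq339Gathering
open Literature.MathematicalPhysics.QuantumFieldTheory.Balaban1983to89.B2Eq337LastIntegrations
open Literature.MathematicalPhysics.QuantumFieldTheory.Balaban1983to89.B2Ineq335Exceptions
open Literature.MathematicalPhysics.QuantumFieldTheory.Balaban1983to89.B2Ineq335Printed

variable {P : HiggsLattice.Params} {N K : ℕ}

/-! ## §1  The kept variables `Φ` of (3.24) as ONE field on `Λ₅⁽⁰⁾ᶜ ⊔ ⋃_k Λ_k` (level 0 of the chain) -/

/-- The sites carrying the kept variables `Φ` of (3.24): `Λ₅⁽⁰⁾ᶜ ⊔ ⨆_{k=1}^{K}Λ_k`. [cite: Balaban1982Higgs2, (3.24) p.588] -/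
abbrev KSite (R : Regions P K) : Type := R.OutSite ⊕ R.BlockSite

/-- The site types of the chain: level 0 = the kept sites, level `n+1` = the output sites `O (n+1)` (↤ `Λ₅⁽ⁿ⁾ᶜ′`,
schematic). [cite: Balaban1982Higgs2, (3.22)–(3.24) p.588, dictionary] -/
def Sites (R : Regions P K) (O : ℕ → Type) : ℕ → Type
  | 0 => KSite R
  | n + 1 => O (n + 1)

/-- the site types are finite. [folklore] [cite: Balaban1982Higgs2, (3.22)–(3.24) p.588, dictionary] -/
instance instFintypeSites (R : Regions P K) (O : ℕ → Type) [∀ i, Fintype (O i)] : ∀ i, Fintype (Sites R O i)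
  | 0 => inferInstanceAs (Fintype (KSite R))
  | n + 1 => inferInstanceAs (Fintype (O (n + 1)))

/-- the site types have decidable equality. [folklore] [cite: Balaban1982Higgs2, (3.22)–(3.24) p.588, dictionary] -/
instance instDecidableEqSites (R : Regions P K) (O : ℕ → Type) [∀ i, DecidableEq (O i)] :
    ∀ i, DecidableEq (Sites R O i)
  | 0 => inferInstanceAs (DecidableEq (KSite R))
  | n + 1 => inferInstanceAs (DecidableEq (O (n + 1)))

/-- `(Λ₅⁽⁰⁾ᶜ ⊔ ⋃Λ_k → ℝ^N) ≃ᵐ Cfg` (Mathlib's `sumPiEquivProdPi`): the kept variables as the pair `Φ` of (3.24).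
[cite: Balaban1982Higgs2, (3.24) p.588] -/
def cfgOf (R : Regions P K) : (KSite R → V N) ≃ᵐ Cfg R N :=
  MeasurableEquiv.sumPiEquivProdPi fun _ : KSite R => V N

/-- the identification is volume-preserving (`dΦ` on both sides). [cite: Balaban1982Higgs2, (3.24) p.588] -/
theorem measurePreserving_cfgOf (R : Regions P K) :
    MeasurePreserving (cfgOf (N := N) R) volume volume :=
  volume_measurePreserving_sumPiEquivProdPi fun _ : KSite R => V N

/-! ## §2  The zero-field Proposition 3.1 data of the concrete carrier in the letters of `B2Ineq335Printed.ineq335` -/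

section Data

variable (R : Regions P K) (C : HiggsLattice.ChargeData N) (a msq : ℝ)

/-- A bond of some scale: `⟨k, b⟩`, `b` a positive bond of `T⁽ᵏ⁾`. [cite: Balaban1982Higgs2, Prop. 3.1 (3.26) p.589] -/
abbrev Bnd (P : HiggsLattice.Params) : Type := Σ k : ℕ, HiggsLattice.PBond P k

/-- The bonds of the k-th term of (3.26): `k = 0` ↦ the bonds inside `Λ₅⁽⁰⁾ᶜ`, `k = n+1 ≤ K` ↦ the bonds inside
`Λ_{n+1}`, none above. [cite: Balaban1982Higgs2, Prop. 3.1 (3.26) p.589] -/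
def bondSet : ℕ → Finset (Bnd P)
  | 0 => (Finset.univ.filter fun c : HiggsLattice.PBond P 0 => Inside (outF R) c).map
      (Function.Embedding.sigmaMk (0 : ℕ))
  | n + 1 =>
    if h : n < K then
      (Finset.univ.filter fun c : HiggsLattice.PBond P (n + 1) => Inside (R.block ⟨n, h⟩) c).map
        (Function.Embedding.sigmaMk (n + 1))
    else ∅

/-- The bond terms of (3.26) at zero field: `(Lᵏε)^d|(∂φ_k)(b)|² = (Lᵏε)^{d−2}|φ_k(b₊) − φ_k(b₋)|²` (`U ≡ 1`), read on the
kept variables (`φ₀` re-glued with `0` on `Λ₅⁽⁰⁾` — irrelevant on the bonds inside `Λ₅⁽⁰⁾ᶜ`; `φ_k` extended by `0` off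
`Λ_k` — irrelevant on the bonds inside `Λ_k`). [cite: Balaban1982Higgs2, Prop. 3.1 (3.26) p.589] -/
def bondTerm (u : KSite R → V N) : Bnd P → ℝ
  | ⟨0, c⟩ => P.mesh 0 ^ P.d *
      ‖HiggsLattice.covDeriv C (0 : HiggsLattice.VecField P 0) (field R (cfgOf R u).1 (0 : InCfg R N)) c‖ ^ 2
  | ⟨k + 1, c⟩ =>
    if h : k < K then
      P.mesh (k + 1) ^ P.d * ‖HiggsLattice.sderiv (extL R ⟨k, h⟩ (resL R ⟨k, h⟩ (cfgOf R u))) c‖ ^ 2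
    else 0

/-- The mass terms of (3.26), aggregated per level: `mass0`, `massK`. [cite: Balaban1982Higgs2, Prop. 3.1 (3.26) p.589] -/
def massTerm (u : KSite R → V N) : ℕ → ℝ
  | 0 => mass0 R msq (cfgOf R u).1
  | k + 1 => if h : k < K then massK R msq ⟨k, h⟩ (resL R ⟨k, h⟩ (cfgOf R u)) else 0

variable {R C a msq}

/-- the bond terms are non-negative. [cite: Balaban1982Higgs2, Prop. 3.1 (3.26) p.589] -/
theorem bondTerm_nonneg (u : KSite R → V N) (b : Bnd P) : 0 ≤ bondTerm R C u b := by
  rcases b with ⟨_ | k, c⟩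
  · exact mul_nonneg (pow_nonneg (P.mesh_pos 0).le _) (sq_nonneg _)
  · simp only [bondTerm]
    split_ifs
    · exact mul_nonneg (pow_nonneg (P.mesh_pos _).le _) (sq_nonneg _)
    · exact le_rfl

/-- the mass terms are non-negative (`m² ≥ 0`). [cite: Balaban1982Higgs2, Prop. 3.1 (3.26) p.589] -/
theorem massTerm_nonneg (hmsq : 0 ≤ msq) (u : KSite R → V N) (n : ℕ) : 0 ≤ massTerm R msq u n := by
  rcases n with _ | k
  · exact mass0_nonneg R hmsq _
  · simp only [massTerm]
    split_ifs
    · exact massK_nonneg R hmsq _ _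
    · exact le_rfl

/-- the level-0 bond sum is `bond0` at `Ã = 0` (`bond0_eq_sum`). [cite: Balaban1982Higgs2, Prop. 3.1 (3.26) p.589] -/
theorem sum_bondSet_zero (u : KSite R → V N) :
    ∑ b ∈ bondSet R 0, bondTerm R C u b = bond0 R C (0 : HiggsLattice.VecField P 0) (cfgOf R u).1 := by
  have hB : bondSet R 0
      = (Finset.univ.filter fun c : HiggsLattice.PBond P 0 => Inside (outF R) c).map
          (Function.Embedding.sigmaMk (β := fun k => HiggsLattice.PBond P k) 0) := rfl
  rw [hB, Finset.sum_map, Finset.sum_filter, bond0_eq_sum]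
  refine Finset.sum_congr rfl fun c _ => ?_
  simp only [Function.Embedding.sigmaMk_apply, bondTerm]

/-- the level-(j+1) bond sum is `bondK j`. [cite: Balaban1982Higgs2, Prop. 3.1 (3.26) p.589] -/
theorem sum_bondSet_succ (u : KSite R → V N) (j : Fin K) :
    ∑ b ∈ bondSet R (j.val + 1), bondTerm R C u b = bondK R j (resL R j (cfgOf R u)) := by
  have hB : bondSet R (j.val + 1)
      = (Finset.univ.filter fun c : HiggsLattice.PBond P (j.val + 1) => Inside (R.block j) c).map
          (Function.Embedding.sigmaMk (β := fun k => HiggsLattice.PBond P k) (j.val + 1)) := by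
    simp only [bondSet, dif_pos j.isLt]
  rw [hB, Finset.sum_map, Finset.sum_filter, bondK]
  refine Finset.sum_congr rfl fun c _ => ?_
  simp only [Function.Embedding.sigmaMk_apply, bondTerm, dif_pos j.isLt]

/-- **the right side of (3.26) at zero field, summed over the levels `k = 0, …, K`**, equals the two sums of
`B2Prop31ZeroFieldConcrete.prop31_zeroField_concrete`. [cite: Balaban1982Higgs2, Prop. 3.1 (3.26) p.589] -/
theorem sum_levels_eq (γ₀ : ℝ) (u : KSite R → V N) :
    ∑ n ∈ range (K + 1), (γ₀ * (∑ b ∈ bondSet R n, bondTerm R C u b + massTerm R msq u n) - 0)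
      = γ₀ * (bond0 R C (0 : HiggsLattice.VecField P 0) (cfgOf R u).1 + ∑ j, bondK R j (resL R j (cfgOf R u)))
        + γ₀ * (mass0 R msq (cfgOf R u).1 + ∑ j, massK R msq j (resL R j (cfgOf R u))) := by
  simp only [sub_zero]
  rw [Finset.sum_range_succ', ← Fin.sum_univ_eq_sum_range (fun n => γ₀ * (∑ b ∈ bondSet R (n + 1),
    bondTerm R C u b + massTerm R msq u (n + 1))) K]
  have h1 : ∀ j : Fin K, γ₀ * (∑ b ∈ bondSet R (j.val + 1), bondTerm R C u b + massTerm R msq u (j.val + 1))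
      = γ₀ * bondK R j (resL R j (cfgOf R u)) + γ₀ * massK R msq j (resL R j (cfgOf R u)) := fun j => by
    rw [sum_bondSet_succ]
    simp only [massTerm, dif_pos j.isLt]
    ring
  have h0 : massTerm R msq u 0 = mass0 R msq (cfgOf R u).1 := rfl
  simp only [h1, h0, sum_bondSet_zero, Finset.sum_add_distrib, ← Finset.mul_sum]
  ring

/-- **PROPOSITION 3.1 AT ZERO FIELD feeds `h326`**: for nested region data (`K ≤` the number of scales, `Lᴷε ≤ 1`),
`m² > 0`, `a > 0`, `L > 1`, EVERY kept configuration: `Σ_{k≤K}(γ₀(Σ_b t_{k,b} + M_k) − 0) ≤ ⟨Φ,Δ(0)Φ⟩ = form325(Φ)` with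
`γ₀ = gamma0` — no restriction on `Φ` and no error terms. [cite: Balaban1982Higgs2, Prop. 3.1 (3.26) p.589] -/
theorem h326_zeroField (hR : Nested R) (hK : K ≤ P.K) (hε : P.mesh K ≤ 1) (ha : 0 < a) (hL : 1 < P.L)
    (hmsq : 0 < msq) (u : KSite R → V N) :
    ∑ n ∈ range (K + 1), (gamma0 P a msq * (∑ b ∈ bondSet R n, bondTerm R C u b + massTerm R msq u n) - 0)
      ≤ form325 R C a (0 : HiggsLattice.VecField P 0) msq (cfgOf R u) := by
  rw [sum_levels_eq]
  exact prop31_zeroField_concrete R C hR hK hε ha hL hmsq (cfgOf R u)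

/-! ### measurability of `Z(0)e^{−¼⟨Φ,Δ(0)Φ⟩}` through `F325` -/

/-- `F325` (the integral (3.23) with constants) is measurable in `Φ` (jointly continuous integrand).
[cite: Balaban1982Higgs2, (3.23)/(3.25) pp.588–589] -/
theorem measurable_F325 (A : HiggsLattice.VecField P 0) : Measurable (F325 R C a A msq) := by
  have h : StronglyMeasurable (Function.uncurry fun (Φ : Cfg R N) (u : InCfg R N) => dens R C a A msq Φ u) :=
    (continuous_dens R C a A msq).stronglyMeasurable
  exact (h.integral_prod_right' (ν := volume)).measurable

/-- `⟨Φ,Δ(Ã^ε)Φ⟩ = −2 log(F325(Φ)/Z(Ã^ε))` ((3.25) solved for the form), hence measurable.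
[cite: Balaban1982Higgs2, (3.25) p.589] -/
theorem measurable_form325 (A : HiggsLattice.VecField P 0) (ha : 0 < a) (hL : 1 < P.L) (hmsq : 0 < msq) :
    Measurable (form325 R C a A msq) := by
  have hZ := Z325_pos R C A ha hL hmsq (N := N)
  have h : ∀ Φ : Cfg R N, form325 R C a A msq Φ = -2 * Real.log (F325 R C a A msq Φ / Z325 R C a A msq) := by
    intro Φ
    rw [eq325_concrete R C A ha hL hmsq Φ, mul_div_cancel_left₀ _ hZ.ne', Real.log_exp]
    ring
  have : form325 R C a A msq = fun Φ => -2 * Real.log (F325 R C a A msq Φ / Z325 R C a A msq) := funext h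
  rw [this]
  exact (Real.measurable_log.comp ((measurable_F325 (R := R) (C := C) (a := a) (msq := msq) A).div_const _)).const_mul _

/-- DICTIONARY: the weight `F` of `rhs322` is (3.25): `Z(0)e^{−½⟨Φ,Δ(0)Φ⟩} = F325(Φ)` on the transported
configuration. [cite: Balaban1982Higgs2, (3.25) p.589] -/
theorem weight_eq_F325 (ha : 0 < a) (hL : 1 < P.L) (hmsq : 0 < msq) (u : KSite R → V N) :
    ENNReal.ofReal (Z325 R C a (0 : HiggsLattice.VecField P 0) msq
        * Real.exp (-(form325 R C a (0 : HiggsLattice.VecField P 0) msq (cfgOf R u) / 2)))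
      = ENNReal.ofReal (F325 R C a (0 : HiggsLattice.VecField P 0) msq (cfgOf R u)) := by
  rw [eq325_concrete R C (0 : HiggsLattice.VecField P 0) ha hL hmsq (cfgOf R u),
    show -(form325 R C a (0 : HiggsLattice.VecField P 0) msq (cfgOf R u) / 2)
        = -(1 / 2 : ℝ) * form325 R C a (0 : HiggsLattice.VecField P 0) msq (cfgOf R u) by ring]

end Data

/-! ## §3  (3.35) AT ZERO FIELD with Proposition 3.1 DISCHARGED on the concrete (3.25) carrier -/

section Ineq335Zero

variable (R : Regions P K) (C : HiggsLattice.ChargeData N) {a msq : ℝ}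
variable {O : ℕ → Type} [∀ i, Fintype (O i)] [∀ i, DecidableEq (O i)]
variable {ι : Fin K → Type*} [∀ j, Fintype (ι j)]

/-- **(3.35) AT ZERO FIELD, PROPOSITION 3.1 DISCHARGED**: for nested region data `R` of the concrete (Higgs)₂,₃
carrier (`K ≤` the number of scales, `Lᴷε ≤ 1`, `m² > 0`, `a > 0`, `L > 1`), the schematic right side of (3.22)
(`B2Ineq335Exceptions.rhs322`) whose level 0 is the space of the kept configurations `Φ` of (3.24) (as fields on
`Λ₅⁽⁰⁾ᶜ ⊔ ⋃Λ_k`, `cfgOf`), whose weight is the zero-field (3.25) `Z(0)exp(−½⟨Φ,Δ(0)Φ⟩)` (= `F325`, `weight_eq_F325`),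
whose bond restrictions `χᶜ_{Q_s⁽ʲ⁾}` concern the CONCRETE bond terms `(Lʲε)^{d−2}|φ_j(b₊) − φ_j(b₋)|²` of (3.26) on the
bonds of `Λ_j` (`bondSet`, `bondTerm`), and whose output structure (the Gaussian renormalization kernels of precision
`a·s_j` with centres `c_j`, the output sites, the exceptional sites `P_s⁽ʲ⁾`, the other characteristic functions `b`,
the family weights `w`) is schematic as in `B2Ineq335Printed.ineq335`, satisfies
`(3.22) ≤ ∫dΦ Z(0)e^{−¼⟨Φ,Δ(0)Φ⟩} · Π_{j<K} Σ_τ w_{j,τ}·e^{−¼γ₀r_j|Q_s⁽ʲ⁾(τ)|}·(e^{−⅛ar_j})^{|P_s⁽ʲ⁾(τ)|}` with `γ₀ = gamma0 =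
min(a(1−L⁻²)/(8d+2m²), ¼)` and NO error factor — the input (3.26) being `B2Prop31ZeroFieldConcrete.prop31_zeroField_concrete`
(*"If Ã^ε = 0, then the inequality holds without the last sum on the right side and without any restrictions"*).
Remaining printed-shape inputs: the meaning of `χᶜ_{Q_s⁽ʲ⁾}` (`hlarge`) and `4N log 2 ≤ a r_j`.
[cite: Balaban1982Higgs2, (3.35) p.591, Prop. 3.1 (3.26) p.589] -/
theorem ineq335_zeroField (hR : Nested R) (hK : K ≤ P.K) (hε : P.mesh K ≤ 1) (ha : 0 < a) (hL : 1 < P.L)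
    (hmsq : 0 < msq) {s : ℕ → ℝ} (hs : ∀ j, 0 < s j)
    {c : (j : ℕ) → ((i : ℕ) → Sites R O i → V N) → Sites R O (j + 1) → V N} (hc : ∀ j, Measurable (c j))
    (hcdep : ∀ j i, j + 1 ≤ i → ∀ (x : (i : ℕ) → Sites R O i → V N) (y : Sites R O i → V N),
      c j (update x i y) = c j x)
    {r : ℕ → ℝ} (hr : ∀ j, 4 * (N : ℝ) * Real.log 2 ≤ a * r j)
    {b : ((i : ℕ) → Sites R O i → V N) → ℝ} (hb : ∀ x, 0 ≤ b x ∧ b x ≤ 1)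
    (w : (j : Fin K) → ι j → ℝ≥0∞) (Q : (j : Fin K) → ι j → Finset (Bnd P)) (hQ : ∀ j τ, Q j τ ⊆ bondSet R j)
    (Pex : (j : Fin K) → ι j → Finset (Sites R O (j + 1)))
    (χQ : (j : Fin K) → ι j → (KSite R → V N) → ℝ) (hχ : ∀ j τ u, χQ j τ u = 0 ∨ χQ j τ u = 1)
    (hlarge : ∀ j τ u, χQ j τ u = 1 → ∀ bb ∈ Q j τ, r j < bondTerm R C u bb)
    (x : (i : ℕ) → Sites R O i → V N) :
    rhs322 (fun i => (volume : Measure (Sites R O i → V N)))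
        (fun u => ENNReal.ofReal (Z325 R C a (0 : HiggsLattice.VecField P 0) msq
          * Real.exp (-(form325 R C a (0 : HiggsLattice.VecField P 0) msq (cfgOf R u) / 2))))
        (fun x => ENNReal.ofReal (b x))
        (gaussLevel (fun j _ => a * s j) c) w (fun j τ u => ENNReal.ofReal (χQ j τ u))
        (fun j τ => excLevel c j (largeFieldSite (Pex j τ) (s j) (r j))) x
      ≤ (∫⁻ u : KSite R → V N, ENNReal.ofReal (Z325 R C a (0 : HiggsLattice.VecField P 0) msq
            * Real.exp (-(form325 R C a (0 : HiggsLattice.VecField P 0) msq (cfgOf R u) / 4))))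
        * ∏ j : Fin K, ∑ τ : ι j, w j τ
            * ENNReal.ofReal (Real.exp (-(gamma0 P a msq * r j * (Q j τ).card / 4)))
            * ENNReal.ofReal (Real.exp (-(a * r j / 8)) ^ (Pex j τ).card) := by
  have hr' : ∀ j, 4 * (Module.finrank ℝ (V N) : ℝ) * Real.log 2 ≤ a * r j := fun j => by
    rw [finrank_V]; exact hr j
  have hX : Measurable (fun u : KSite R → V N =>
      form325 R C a (0 : HiggsLattice.VecField P 0) msq (cfgOf R u)) :=
    (measurable_form325 (R := R) (C := C) (0 : HiggsLattice.VecField P 0) ha hL hmsq).comp (cfgOf R).measurable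
  have key := ineq335 (S := Sites R O) (ι := ι) ha hs hc hcdep hr'
    (Z325_pos R C (0 : HiggsLattice.VecField P 0) ha hL hmsq).le hX (bondSet R)
    (fun _ bb u => bondTerm R C u bb) (fun _ bb _ u => bondTerm_nonneg u bb)
    (M := fun n u => massTerm R msq u n) (fun n u => massTerm_nonneg hmsq.le u n) (fun _ => (0 : ℝ))
    (gamma0_pos ha hL hmsq.le).le hb (fun x _ => h326_zeroField (R := R) (C := C) hR hK hε ha hL hmsq (x 0))
    w Q hQ Pex χQ hχ hlarge x
  simp only [Finset.sum_const_zero, zero_div, Real.exp_zero, ENNReal.ofReal_one, one_mul] at key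
  exact key

end Ineq335Zero

/-! ## §4  The knit: (3.35)₀ ⇒ (3.36) ⇒ (3.37) ⇒ (3.38) ⇒ (3.39) with NO (3.35)/(3.26) hypothesis left -/

section Knit

variable (R : Regions P K) (C : HiggsLattice.ChargeData N) {a msq : ℝ}
variable {O : ℕ → Type} [∀ i, Fintype (O i)] [∀ i, DecidableEq (O i)]
variable {ι : Fin K → Type*} [∀ j, Fintype (ι j)]

/-- `∫dΦ Z(0)e^{−¼⟨Φ,Δ(0)Φ⟩}` is a genuine (finite, integrable) integral: it equals `2^{dim/2}∫F325 = 2^{dim/2}∫dφ₀e^{−½⟨φ₀,(−Δ+m²)φ₀⟩}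
> 0` ((3.36) = (3.37), gen 4). [cite: Balaban1982Higgs2, (3.36)–(3.37) p.591] -/
theorem integrable_weight4 (A : HiggsLattice.VecField P 0) (ha : 0 < a) (hL : 1 < P.L) (hmsq : 0 < msq) :
    Integrable (fun Φ : Cfg R N => Z325 R C a A msq * Real.exp (-(form325 R C a A msq Φ / 4))) := by
  refine Integrable.of_integral_ne_zero ?_
  rw [eq336_concrete R C A ha hL hmsq, eq337 R C A ha hL hmsq]
  exact mul_ne_zero (Real.rpow_pos_of_pos (by norm_num) _).ne' (integral_gField_pos C A hmsq).ne'

/-- the `[0,∞]`-integral over the transported kept variables is the real integral `∫dΦ Z(0)e^{−¼⟨Φ,Δ(0)Φ⟩}`.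
[cite: Balaban1982Higgs2, (3.35)–(3.36) p.591] -/
theorem lintegral_weight4_eq (A : HiggsLattice.VecField P 0) (ha : 0 < a) (hL : 1 < P.L) (hmsq : 0 < msq) :
    ∫⁻ u : KSite R → V N, ENNReal.ofReal (Z325 R C a A msq * Real.exp (-(form325 R C a A msq (cfgOf R u) / 4)))
      = ENNReal.ofReal (∫ Φ : Cfg R N, Z325 R C a A msq * Real.exp (-(form325 R C a A msq Φ / 4))) := by
  rw [(measurePreserving_cfgOf (N := N) R).lintegral_comp_emb (cfgOf R).measurableEmbedding
    (fun Φ : Cfg R N => ENNReal.ofReal (Z325 R C a A msq * Real.exp (-(form325 R C a A msq Φ / 4))))]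
  rw [ofReal_integral_eq_lintegral_ofReal (integrable_weight4 R C A ha hL hmsq)
    (ae_of_all _ fun Φ => mul_nonneg (Z325_pos R C A ha hL hmsq).le (Real.exp_pos _).le)]

/-- **(3.22) ⇒ (3.39) AT ZERO FIELD ON THE CONCRETE CARRIER, NO (3.26)/(3.35) HYPOTHESIS**: the gen-4 knit
`B2Ineq339Gathering.ineq339_knit` (= r14's `ineq339_of_335_338` with (3.36), (3.37), (3.38) discharged on the concrete
carrier) with its `h335` now SUPPLIED by `ineq335_zeroField` for `lhs :=` the (finite) value of the schematic right side
of (3.22): `(3.22) ≤ Π_{j<K}ζ′_j · exp(E_{0,s}) · exp(½N log 2 · (|Λ₅⁽⁰⁾ᶜ| + Σ_k|Λ_k|))` with `ζ′_j = Σ_τ w_{j,τ}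
e^{−¼γ₀r_j|Q_s⁽ʲ⁾(τ)|}(e^{−⅛ar_j})^{|P_s⁽ʲ⁾(τ)|}` (real weights `w ≥ 0`) — the printed (3.39) with `O(1) = ½N log 2` (no
`O((Lᵏε)^{κ₀})` term at zero field). [cite: Balaban1982Higgs2, (3.35)–(3.39) p.591] -/
theorem ineq339_zeroField (hR : Nested R) (hK : K ≤ P.K) (hε : P.mesh K ≤ 1) (ha : 0 < a) (hL : 1 < P.L)
    (hmsq : 0 < msq) {s : ℕ → ℝ} (hs : ∀ j, 0 < s j)
    {c : (j : ℕ) → ((i : ℕ) → Sites R O i → V N) → Sites R O (j + 1) → V N} (hc : ∀ j, Measurable (c j))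
    (hcdep : ∀ j i, j + 1 ≤ i → ∀ (x : (i : ℕ) → Sites R O i → V N) (y : Sites R O i → V N),
      c j (update x i y) = c j x)
    {r : ℕ → ℝ} (hr : ∀ j, 4 * (N : ℝ) * Real.log 2 ≤ a * r j)
    {b : ((i : ℕ) → Sites R O i → V N) → ℝ} (hb : ∀ x, 0 ≤ b x ∧ b x ≤ 1)
    (w : (j : Fin K) → ι j → ℝ) (hw : ∀ j τ, 0 ≤ w j τ)
    (Q : (j : Fin K) → ι j → Finset (Bnd P)) (hQ : ∀ j τ, Q j τ ⊆ bondSet R j)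
    (Pex : (j : Fin K) → ι j → Finset (Sites R O (j + 1)))
    (χQ : (j : Fin K) → ι j → (KSite R → V N) → ℝ) (hχ : ∀ j τ u, χQ j τ u = 0 ∨ χQ j τ u = 1)
    (hlarge : ∀ j τ u, χQ j τ u = 1 → ∀ bb ∈ Q j τ, r j < bondTerm R C u bb)
    (x : (i : ℕ) → Sites R O i → V N) :
    (rhs322 (fun i => (volume : Measure (Sites R O i → V N)))
        (fun u => ENNReal.ofReal (Z325 R C a (0 : HiggsLattice.VecField P 0) msq
          * Real.exp (-(form325 R C a (0 : HiggsLattice.VecField P 0) msq (cfgOf R u) / 2))))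
        (fun x => ENNReal.ofReal (b x))
        (gaussLevel (fun j _ => a * s j) c) (fun j τ => ENNReal.ofReal (w j τ))
        (fun j τ u => ENNReal.ofReal (χQ j τ u))
        (fun j τ => excLevel c j (largeFieldSite (Pex j τ) (s j) (r j))) x).toReal
      ≤ (∏ j : Fin K, ∑ τ : ι j, w j τ * Real.exp (-(gamma0 P a msq * r j * (Q j τ).card / 4))
            * Real.exp (-(a * r j / 8)) ^ (Pex j τ).card)
        * Real.exp (E0s P C msq)
        * Real.exp (((N : ℝ) * Real.log 2 / 2 + 0) * ∑ k ∈ Finset.range (K + 1), vol R k) := by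
  have key := ineq335_zeroField R C hR hK hε ha hL hmsq hs hc hcdep hr hb (fun j τ => ENNReal.ofReal (w j τ))
    Q hQ Pex χQ hχ hlarge x
  -- the real numbers of (3.35): I₄ and Z′ = Πζ′
  set I₄ : ℝ := ∫ Φ : Cfg R N, Z325 R C a (0 : HiggsLattice.VecField P 0) msq
    * Real.exp (-(form325 R C a (0 : HiggsLattice.VecField P 0) msq Φ / 4)) with hI₄
  set Zp : ℝ := ∏ j : Fin K, ∑ τ : ι j, w j τ * Real.exp (-(gamma0 P a msq * r j * (Q j τ).card / 4))
    * Real.exp (-(a * r j / 8)) ^ (Pex j τ).card with hZp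
  have hterm0 : ∀ j τ, 0 ≤ w j τ * Real.exp (-(gamma0 P a msq * r j * (Q j τ).card / 4))
      * Real.exp (-(a * r j / 8)) ^ (Pex j τ).card := fun j τ => by
    have := hw j τ; positivity
  have hZp0 : 0 ≤ Zp := Finset.prod_nonneg fun j _ => Finset.sum_nonneg fun τ _ => hterm0 j τ
  have hI0 : 0 ≤ I₄ :=
    integral_nonneg fun Φ => mul_nonneg (Z325_pos R C _ ha hL hmsq).le (Real.exp_pos _).le
  -- the `[0,∞]` right side of `key` is `ofReal (I₄ * Zp)`
  have hZ : (∏ j : Fin K, ∑ τ : ι j, ENNReal.ofReal (w j τ)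
        * ENNReal.ofReal (Real.exp (-(gamma0 P a msq * r j * (Q j τ).card / 4)))
        * ENNReal.ofReal (Real.exp (-(a * r j / 8)) ^ (Pex j τ).card)) = ENNReal.ofReal Zp := by
    rw [hZp, ENNReal.ofReal_prod_of_nonneg fun j _ => Finset.sum_nonneg fun τ _ => hterm0 j τ]
    refine Finset.prod_congr rfl fun j _ => ?_
    rw [ENNReal.ofReal_sum_of_nonneg fun τ _ => hterm0 j τ]
    refine Finset.sum_congr rfl fun τ _ => ?_
    rw [ENNReal.ofReal_mul (mul_nonneg (hw j τ) (Real.exp_pos _).le), ENNReal.ofReal_mul (hw j τ)]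
  rw [lintegral_weight4_eq R C (0 : HiggsLattice.VecField P 0) ha hL hmsq, hZ, ← hI₄,
    ← ENNReal.ofReal_mul hI0] at key
  have h4 := ENNReal.toReal_mono ENNReal.ofReal_ne_top key
  rw [ENNReal.toReal_ofReal (mul_nonneg hI0 hZp0)] at h4
  -- (3.35) in r14's real shape with c ≡ 0, then the gen-4 knit (3.36)–(3.39)
  have h335 := h4.trans (le_of_eq
    (show I₄ * Zp = I₄ * Zp * Real.exp (∑ k ∈ Finset.Icc 1 K, (fun _ : ℕ => (0 : ℝ)) k * vol R k) by simp))
  exact ineq339_knit R C (0 : HiggsLattice.VecField P 0) ha hL hmsq hZp0 (C₀ := 0) (c := fun _ : ℕ => (0 : ℝ))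
    (fun k => by simp) h335

end Knit

end Literature.MathematicalPhysics.QuantumFieldTheory.Balaban1983to89.B2Ineq335ZeroFieldConcrete

end
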